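import Mathlib
import HarnessLib
import Literature.Computability.QuantumComplexity.ApproxStabilizerRankQuadratic
import Literature.Computability.QuantumComplexity.ApproxStabilizerRankTransfer
import Literature.Computability.QuantumComplexity.ApproxStabilizerRankTransferProofs
import Literature.Computability.QuantumComplexity.ApproxStabilizerRankSignWitness
import Literature.Computability.QuantumComplexity.SignStateKickbackSynthesis
import Literature.Computability.QuantumComplexity.QStateL2

/-!
# Mehraban–Tahmasbi 2024, Theorem 3.1 — the assembly of §3.4, proved; `χ_δ` under perturbation

Companion ("Proofs" sibling) of `ApproxStabilizerRankQuadratic.lean`, whose single named fact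
`MehrabanTahmasbi2024_approxRank_magicT_quadratic` is Theorem 3.1 of S. Mehraban, M. Tahmasbi,
*Quadratic lower bounds on the approximate stabilizer rank: a probabilistic approach*, STOC 2024 =
arXiv:2305.10277 (`χ_δ(|T⟩^{⊗m}) = Ω((1−δ²)² m²/polylog m)` for `0 < δ < 1`; held text read,
§3, arXiv pp. 12–15). Everything in this file is PROVED; no new named fact is introduced.

The printed proof (§3, p. 12) has four ingredients and a half-page of glue (§3.4, pp. 14–15):

| ingredient | in print | in the tree |
|---|---|---|
| Lemma 3.2 | Haar-typical `n`-qubit states have `χ_δ ≥ C(1−δ²)²2ⁿ/n²` (Lévy concentration, `|STAB_n| ≤ e^{0.54n²}`) | fact `MehrabanTahmasbi2024_exists_large_approxRank` (`ApproxStabilizerRankTransfer.lean`) |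
| Lemma 3.5 | Low–Kliuchnikov–Schaeffer: `τ_{4^{-n}}(φ) = 2^{n/2}·O(n)` `T` gates prepare any `φ ⊗ |0^λ⟩` | not vendored — hypothesis `h35` below, stated as printed |
| Lemma 3.6 | `χ_δ(V|0⟩) ≤ χ_δ(|T⟩^{⊗k})` for a Clifford+`T` circuit with `k` `T` gates | fact `MehrabanTahmasbi2024_approxRank_output_le` |
| §3.4 (a) | `χ_δ(φ) ≤ χ_δ(φ ⊗ |0^λ⟩)` | fact `MehrabanTahmasbi2024_approxRank_le_tensor_zeroState` |

This file proves the GLUE as the conditional theorem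
`MehrabanTahmasbi2024_approxRank_magicT_quadratic_of_lemmas : L3.2 → L3.5 → L3.6 → (a) → Thm 3.1`
over the tree's `approxStabilizerRank`, `tensorPow magicT`, `QCircuit cliffordT`, `tCount`
(so that the fact is discharged the moment its four ingredients are), together with the
elementary, unconditional pieces the glue needs:

* `approxStabilizerRank_anti` — `χ_δ(ψ)` is antitone in `δ`;
* `approxStabilizerRank_add_le` — perturbation: `‖ψ − ψ'‖ ≤ ε ⇒ χ_{δ+ε}(ψ') ≤ χ_δ(ψ)`;
* `exists_tCount_eq_add` — an oracle-free Clifford+`T` circuit on `N ≥ 1` wires can be padded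
  with `T` gates on `|0⟩` (where `T` acts trivially) to any larger `T`-count, same output on `|0^N⟩`;
* `MehrabanTahmasbi2024.exists_bracket`, `MehrabanTahmasbi2024.quadratic_arith` — the choice
  "largest `n = 2k` with `c n 2^{n/2} ≤ m`" and the final estimate `2ⁿ/n² ≥ c' m²/log⁴ m`.

## Deviations from print (all weakenings of what is used, none of what is concluded)

* The paper applies Lemma 3.2 with the moving parameter `δ + 4^{-n}`; we apply it once with the
  fixed `δ₁ = (1+δ)/2` and use antitonicity (`δ + 4^{-n} ≤ δ₁` for large `n`), which only changes
  the constant — the fact's rendering has `∃ c > 0, ∃ A` anyway (we get `A = 4` as in print).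
* `n` is taken even (`n = 2k`, so `2^{n/2} = 2^k` is an integer); "at most `m` `T` gates" is
  turned into "exactly `m`" by `exists_tCount_eq_add` before Lemma 3.6 is invoked.

## References

* [MehrabanTahmasbi2024] arXiv:2305.10277: Thm 3.1, Lemma 3.2 (p. 12), Def. 2.1 (p. 10),
  Lemma 3.5 (p. 13), Lemma 3.6 (p. 13), §3.4 (pp. 14–15).
* [LowKliuchnikovSchaeffer2024] G. H. Low, V. Kliuchnikov, L. Schaeffer, *Trading T gates for
  dirty qubits in state preparation and unitary synthesis*, Quantum 8 (2024) 1375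
  (= arXiv:1812.00954): the source of Lemma 3.5.

## The discharge (sign-state route)

`theorem MehrabanTahmasbi2024_approxRank_magicT_quadratic_holds` — the fact is PROVED at the end
of this file, not through `h35` (Low–Kliuchnikov–Schaeffer synthesis is not in the tree) but by the
exact sign-state route: the Lemma 3.2 witness of the tree is a SIGN state
`φ_s = 2^{-n/2} Σₓ (−1)^{s(x)} |x⟩` (`MehrabanTahmasbi2024_exists_large_approxRank_signVec`,
`ApproxStabilizerRankSignWitness.lean`), and sign states are prepared EXACTLY by `H^{⊗n}`, one
exact reversible Boolean oracle with `O(2^{n/2})` Toffoli gates (`boolOracle_exact`,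
`BooleanFunctionOracle.lean`; Gosset–Kothari–Wu 2024, Lemma 2.1 / Remark 2.2) and phase kickback
(`signState_exact_synthesis`, `SignStateKickbackSynthesis.lean`), with `T`-count `≤ 56 · 2^{n/2}`
— so the perturbation step disappears (`MehrabanTahmasbi2024_approxRank_magicT_quadratic_of_signStubs`,
constants `A = 4`, `c = C (1−δ²)² (log 2)⁴ / (64 · 57²)`). The conditional `…_of_lemmas` (printed
route through `h35`) is kept.
-/

noncomputable section

open Matrix

namespace Literature.Computability.QuantumComplexity

open Cryptography

/-! ### Generic API: `χ_δ` is antitone in `δ` and stable under perturbation -/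

/-- The tree's `normSq` is the square of the `ℓ₂` norm `QState.l2`. [folklore] -/
theorem normSq_eq_l2_sq {n : ℕ} (ψ : QReg n → ℂ) : normSq ψ = QState.l2 ψ ^ 2 := by
  rw [QState.l2_sq]; rfl

/-- The set whose infimum is `χ_δ(ψ)` is nonempty (it contains `χ(ψ)`, via `φ = ψ`). [folklore] -/
theorem approxStabilizerRank_set_nonempty {n : ℕ} (δ : ℝ) (ψ : QReg n → ℂ) :
    {r | ∃ φ : QReg n → ℂ, normSq (ψ - φ) ≤ δ ^ 2 ∧ stabilizerRank φ = r}.Nonempty :=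
  ⟨stabilizerRank ψ, ψ, by simp [Cryptography.normSq, sq_nonneg], rfl⟩

/-- `χ_δ(ψ)` is attained: some `φ` with `‖ψ - φ‖ ≤ δ` has `χ(φ) = χ_δ(ψ)`. [folklore] -/
theorem exists_eq_approxStabilizerRank {n : ℕ} (δ : ℝ) (ψ : QReg n → ℂ) :
    ∃ φ : QReg n → ℂ, normSq (ψ - φ) ≤ δ ^ 2 ∧ stabilizerRank φ = approxStabilizerRank δ ψ :=
  Nat.sInf_mem (approxStabilizerRank_set_nonempty δ ψ)

/-- **`χ_δ` is antitone in `δ`**: `δ² ≤ δ'² → χ_{δ'}(ψ) ≤ χ_δ(ψ)`. [Bravyi et al. 2019, §2] [folklore] -/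
theorem approxStabilizerRank_anti {n : ℕ} {δ δ' : ℝ} (h : δ ^ 2 ≤ δ' ^ 2) (ψ : QReg n → ℂ) :
    approxStabilizerRank δ' ψ ≤ approxStabilizerRank δ ψ := by
  obtain ⟨φ, hφ, hr⟩ := exists_eq_approxStabilizerRank δ ψ
  exact hr ▸ Nat.sInf_le ⟨φ, hφ.trans h, rfl⟩

/-- **Perturbation**: if `‖ψ - ψ'‖ ≤ ε` then `χ_{δ+ε}(ψ') ≤ χ_δ(ψ)` (`δ, ε ≥ 0`): an approximate
decomposition of `ψ` within `δ` is one of `ψ'` within `δ + ε` (triangle inequality). This is the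
step `χ_δ(V|0^{n+λ}⟩) ≥ χ_{δ+4^{-n}}(φ ⊗ |0^λ⟩)` of Mehraban–Tahmasbi 2024, §3.4.
[cite: MehrabanTahmasbi2024, §3.4] -/
theorem approxStabilizerRank_add_le {n : ℕ} {δ ε : ℝ} (hδ : 0 ≤ δ) (hε : 0 ≤ ε)
    {ψ ψ' : QReg n → ℂ} (h : normSq (ψ - ψ') ≤ ε ^ 2) :
    approxStabilizerRank (δ + ε) ψ' ≤ approxStabilizerRank δ ψ := by
  obtain ⟨φ, hφ, hr⟩ := exists_eq_approxStabilizerRank δ ψ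
  rw [normSq_eq_l2_sq] at hφ h
  have h1 : QState.l2 (ψ - φ) ≤ δ := (sq_le_sq₀ (QState.l2_nonneg _) hδ).1 hφ
  have h2 : QState.l2 (ψ' - ψ) ≤ ε := by
    rw [QState.l2_sub_comm]; exact (sq_le_sq₀ (QState.l2_nonneg _) hε).1 h
  have h3 : QState.l2 (ψ' - φ) ≤ δ + ε :=
    (QState.l2_sub_le ψ' ψ φ).trans (by linarith)
  refine hr ▸ Nat.sInf_le ⟨φ, ?_, rfl⟩
  rw [normSq_eq_l2_sq]
  exact pow_le_pow_left₀ (QState.l2_nonneg _) h3 2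

/-! ### Padding a Clifford+`T` circuit with `T` gates acting on `|0⟩` -/

/-- A placement of the `T` gate fixes `|0^N⟩` (`T|0⟩ = |0⟩`). [Nielsen–Chuang 2010, §4.2] [folklore] -/
theorem placeGate_tGate_mulVec_zeroState {N : ℕ} (e : Fin 1 ↪ Fin N) :
    placeGate e tGate *ᵥ zeroState N = zeroState N := by
  funext x
  have hsum : (placeGate e tGate *ᵥ zeroState N) x = placeGate e tGate x (fun _ => false) := by
    simp only [Matrix.mulVec, dotProduct, Cryptography.zeroState, Cryptography.basisState_apply,
      mul_ite, mul_one, mul_zero, Finset.sum_ite_eq', Finset.mem_univ, if_true]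
  rw [hsum, Cryptography.placeGate_apply]
  simp only [Cryptography.zeroState, Cryptography.basisState_apply, Cryptography.tGate,
    Matrix.of_apply]
  by_cases hx : x = fun _ => false
  · subst hx
    simp
  · rw [if_neg hx]
    split_ifs with h1 h2 h3
    · exfalso
      exact absurd (congrFun h2 0) (by simpa using h3)
    · exfalso
      apply hx
      funext i
      by_cases hi : i ∈ Set.range e
      · obtain ⟨j, rfl⟩ := hi
        have := congrFun h2 j
        simpa using this
      · exact h1 i hi
    · rfl
    · rfl

/-- **`T`-padding.** On `N ≥ 1` wires, an oracle-free Clifford+`T` circuit `U` can be extended by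
`j` further `T` gates without changing `U|0^N⟩`: prepend `T` gates on wire `0`, which act on
`|0⟩` as the identity. Used to pass from "at most `m` `T` gates" (Lemma 3.5) to "exactly `m`"
in Lemma 3.6. [folklore] -/
theorem exists_tCount_eq_add {N : ℕ} (hN : 1 ≤ N) (U : QCircuit cliffordT N)
    (hU : U.IsOracleFree) (j : ℕ) (A : Language Bool) :
    ∃ U' : QCircuit cliffordT N, U'.IsOracleFree ∧ U'.tCount = U.tCount + j ∧
      U'.toMatrix A *ᵥ zeroState N = U.toMatrix A *ᵥ zeroState N := by
  induction j with
  | zero => exact ⟨U, hU, rfl, rfl⟩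
  | succ j ih =>
    obtain ⟨U', hU'free, hU't, hU'0⟩ := ih
    let e : Fin 1 ↪ Fin N := ⟨fun _ => ⟨0, hN⟩, fun a b _ => Subsingleton.elim a b⟩
    refine ⟨⟨QGate.gate CliffordTOp.T e :: U'.gates⟩, ?_, ?_, ?_⟩
    · intro g hg
      rcases List.mem_cons.mp hg with rfl | hg
      · trivial
      · exact hU'free g hg
    · rw [QCircuit.tCount_cons, QGate.isT_gate_T, if_pos rfl, hU't, Nat.add_assoc]
    · calc (⟨QGate.gate CliffordTOp.T e :: U'.gates⟩ : QCircuit cliffordT N).toMatrix A *ᵥ zeroState N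
          = U'.toMatrix A *ᵥ (placeGate e tGate *ᵥ zeroState N) := by
            rw [QCircuit.toMatrix_cons, ← Matrix.mulVec_mulVec]; rfl
        _ = U.toMatrix A *ᵥ zeroState N := by rw [placeGate_tGate_mulVec_zeroState, hU'0]

/-! ### The choice of `n` in §3.4 and the final estimate -/

namespace MehrabanTahmasbi2024

/-- **Bracketing.** For `D₀ ≥ 1` and `D₀ k₀ 2^{k₀} ≤ m` there is `k ≥ k₀` with
`D₀ k 2^k ≤ m < D₀ (k+1) 2^{k+1}` ("choose the largest `n` such that `c n 2^{n/2} ≤ m`",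
Mehraban–Tahmasbi 2024, §3.4, with `n = 2k`). [cite: MehrabanTahmasbi2024, §3.4] -/
theorem exists_bracket {D₀ k₀ m : ℕ} (hD : 1 ≤ D₀) (hm : D₀ * k₀ * 2 ^ k₀ ≤ m) :
    ∃ k, k₀ ≤ k ∧ D₀ * k * 2 ^ k ≤ m ∧ m < D₀ * (k + 1) * 2 ^ (k + 1) := by
  classical
  let P : ℕ → Prop := fun k => D₀ * k * 2 ^ k ≤ m
  have hPbound : ∀ j, P j → j ≤ m := by
    intro j hj
    rcases Nat.eq_zero_or_pos j with rfl | hj0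
    · exact Nat.zero_le _
    · calc j ≤ 2 ^ j := Nat.lt_two_pow_self.le
        _ ≤ D₀ * j * 2 ^ j := Nat.le_mul_of_pos_left _ (Nat.mul_pos hD hj0)
        _ ≤ m := hj
  refine ⟨Nat.findGreatest P m, Nat.le_findGreatest (P := P) (hPbound k₀ hm) hm,
    Nat.findGreatest_spec (P := P) (hPbound k₀ hm) hm, ?_⟩
  exact not_le.mp fun hP1 =>
    Nat.findGreatest_is_greatest (P := P) (Nat.lt_succ_self _) (hPbound _ hP1) hP1

/-- **The arithmetic of §3.4.** With `n = 2k`, `k log 2 ≤ L` (i.e. `2^k ≤ m`), `log 2 ≤ L` and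
`m < 2 D₀ (k+1) 2^k`: `K (log 2)⁴/(64 D₀²) · m²/L⁴ ≤ K · 2^{2k}/(2k)²`. [cite: MehrabanTahmasbi2024, §3.4] -/
theorem quadratic_arith {K l L : ℝ} {D₀ k m : ℕ} (hK : 0 < K) (hD : 1 ≤ D₀) (hk : 1 ≤ k)
    (hl : 0 < l) (hlL : l ≤ L) (hkL : (k : ℝ) * l ≤ L)
    (hm : (m : ℝ) < 2 * D₀ * (k + 1) * 2 ^ k) :
    K * l ^ 4 / (64 * (D₀ : ℝ) ^ 2) * (m : ℝ) ^ 2 / L ^ 4 ≤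
      K * 2 ^ (2 * k) / ((2 * k : ℕ) : ℝ) ^ 2 := by
  have hD' : (0 : ℝ) < D₀ := by exact_mod_cast hD
  have hk' : (0 : ℝ) < k := by exact_mod_cast hk
  have hL : 0 < L := lt_of_lt_of_le hl hlL
  have hm0 : (0 : ℝ) ≤ m := Nat.cast_nonneg m
  have h2k : ((2 * k : ℕ) : ℝ) = 2 * k := by push_cast; ring
  have hpow : (2 : ℝ) ^ (2 * k) = ((2 : ℝ) ^ k) ^ 2 := by rw [← pow_mul, mul_comm]
  rw [h2k, hpow, div_mul_eq_mul_div, div_div, div_le_div_iff₀ (by positivity) (by positivity)]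
  have h1 : (k : ℝ) ^ 2 * l ^ 2 ≤ L ^ 2 := by
    rw [← mul_pow]; exact pow_le_pow_left₀ (by positivity) hkL 2
  have h2 : ((k : ℝ) + 1) ^ 2 * l ^ 2 ≤ 4 * L ^ 2 := by
    have : ((k : ℝ) + 1) * l ≤ 2 * L := by nlinarith
    nlinarith
  have h3 : (m : ℝ) ^ 2 ≤ (2 * D₀ * (k + 1) * 2 ^ k) ^ 2 := pow_le_pow_left₀ hm0 hm.le 2
  calc K * l ^ 4 * (m : ℝ) ^ 2 * (2 * (k : ℝ)) ^ 2
      = 4 * K * ((k : ℝ) ^ 2 * l ^ 2) * (l ^ 2 * (m : ℝ) ^ 2) := by ring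
    _ ≤ 4 * K * L ^ 2 * (l ^ 2 * (2 * D₀ * (k + 1) * 2 ^ k) ^ 2) := by gcongr
    _ = 16 * K * L ^ 2 * (D₀ : ℝ) ^ 2 * ((2 : ℝ) ^ k) ^ 2 * (((k : ℝ) + 1) ^ 2 * l ^ 2) := by ring
    _ ≤ 16 * K * L ^ 2 * (D₀ : ℝ) ^ 2 * ((2 : ℝ) ^ k) ^ 2 * (4 * L ^ 2) := by gcongr
    _ = K * ((2 : ℝ) ^ k) ^ 2 * (64 * (D₀ : ℝ) ^ 2 * L ^ 4) := by ring

end MehrabanTahmasbi2024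

/-! ### Theorem 3.1 from Lemmas 3.2, 3.5, 3.6 and §3.4 (a) -/

/-- **Mehraban–Tahmasbi 2024, §3.4 ("Concluding the proof of Theorem 3.1")**, as a conditional
theorem: the quadratic lower bound `MehrabanTahmasbi2024_approxRank_magicT_quadratic`
(`χ_δ(|T⟩^{⊗m}) = Ω(m²/log⁴ m)` for `0 < δ < 1`) follows from

* `h32` — Lemma 3.2 (Haar-typical `n`-qubit states have `χ_δ ≥ C(1−δ²)² 2ⁿ/n²`),
* `h35` — Lemma 3.5 (Low–Kliuchnikov–Schaeffer, LowKliuchnikovSchaeffer2024, via Def. 2.1: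
  "`τ_{4^{-n}}(φ) = 2^{n/2} O(n)`"): every unit `n`-qubit `φ`, `n ≥ 1`, is `4^{-n}`-close, after
  tensoring with clean ancillas `|0^λ⟩`, to `U|0^{n+λ}⟩` for an oracle-free Clifford+`T` circuit
  `U` with at most `c·n·√2ⁿ` `T` gates — stated inline, as printed, because the tree has no
  vendored form of it,
* `h36` — Lemma 3.6 (`χ_δ(V|0⟩) ≤ χ_δ(|T⟩^{⊗k})` for `T`-count `k`),
* `h34a` — §3.4 (a) (`χ_δ(φ) ≤ χ_δ(φ ⊗ |0^λ⟩)`),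

by the printed argument: given `m`, take the largest `n = 2k` with `D₀ k 2^k ≤ m` (`D₀ ≥ 2c`),
a state `φ` of Lemma 3.2 at `δ₁ = (1+δ)/2` on `n` qubits, its circuit `U` of Lemma 3.5 padded with
`T` gates on `|0⟩` to `T`-count exactly `m`; then
`χ_δ(|T⟩^{⊗m}) ≥ χ_δ(U|0⟩) ≥ χ_{δ+4^{-n}}(φ ⊗ |0^λ⟩) ≥ χ_{δ+4^{-n}}(φ) ≥ χ_{δ₁}(φ) ≥ C(1−δ₁²)² 2ⁿ/n²
 ≥ C(1−δ₁²)² (log 2)⁴/(64 D₀²) · m²/log⁴ m`. (The paper keeps `δ + 4^{-n}` in Lemma 3.2; using the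
fixed `δ₁` and antitonicity of `χ_δ` in `δ` only changes the constant.)
[cite: MehrabanTahmasbi2024, §3.4 (arXiv pp. 14–15)] -/
theorem MehrabanTahmasbi2024_approxRank_magicT_quadratic_of_lemmas
    (h32 : MehrabanTahmasbi2024_exists_large_approxRank)
    (h35 : ∃ c : ℝ, ∀ n : ℕ, 1 ≤ n → ∀ φ : QReg n → ℂ, normSq φ = 1 →
      ∃ (anc : ℕ) (U : QCircuit cliffordT (n + anc)), U.IsOracleFree ∧
        (U.tCount : ℝ) ≤ c * n * Real.sqrt 2 ^ n ∧
        normSq (U.toMatrix 0 *ᵥ zeroState (n + anc) - tensorVec φ (zeroState anc)) ≤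
          ((1 / 4 : ℝ) ^ n) ^ 2)
    (h36 : MehrabanTahmasbi2024_approxRank_output_le)
    (h34a : MehrabanTahmasbi2024_approxRank_le_tensor_zeroState) :
    MehrabanTahmasbi2024_approxRank_magicT_quadratic := by
  intro δ hδ0 hδ1
  obtain ⟨C, hC, h32⟩ := h32
  obtain ⟨c, h35⟩ := h35
  -- the auxiliary approximation parameter `δ₁ ∈ (δ, 1)` and the constants
  set δ₁ : ℝ := (1 + δ) / 2 with hδ₁def
  have hδ₁0 : 0 < δ₁ := by rw [hδ₁def]; linarith
  have hδ₁1 : δ₁ < 1 := by rw [hδ₁def]; linarith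
  have h1δ₁ : 0 < 1 - δ₁ ^ 2 := by nlinarith
  have hC0 : 0 < C := by linarith
  have hl2 : 0 < Real.log 2 := Real.log_pos (by norm_num)
  obtain ⟨k₁, hk₁⟩ : ∃ k₁ : ℕ, (1 / 4 : ℝ) ^ k₁ < (1 - δ) / 2 :=
    exists_pow_lt_of_lt_one (by linarith) (by norm_num)
  set D₀ : ℕ := ⌈2 * c⌉₊ + 1 with hD₀def
  have hD₀c : 2 * c ≤ (D₀ : ℝ) := by
    rw [hD₀def]; push_cast
    exact (Nat.le_ceil (2 * c)).trans (le_add_of_nonneg_right zero_le_one)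
  have hD₀1 : 1 ≤ D₀ := by rw [hD₀def]; exact Nat.le_add_left 1 _
  have hD₀pos : (0 : ℝ) < D₀ := by exact_mod_cast hD₀1
  set N₁ : ℝ := 2 * Real.logb 2 (1 / (1 - δ₁ ^ 2)) + 9 with hN₁def
  set k₀ : ℕ := max (max 1 ⌈N₁⌉₊) k₁ with hk₀def
  refine ⟨C * (1 - δ₁ ^ 2) ^ 2 * Real.log 2 ^ 4 / (64 * (D₀ : ℝ) ^ 2), by positivity, 4,
    max (D₀ * k₀ * 2 ^ k₀) 2, fun m hm => ?_⟩
  have hm2 : 2 ≤ m := le_of_max_le_right hm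
  have hmf : D₀ * k₀ * 2 ^ k₀ ≤ m := le_of_max_le_left hm
  -- the choice of `n = 2k`
  obtain ⟨k, hk₀k, hkm, hmk⟩ := MehrabanTahmasbi2024.exists_bracket hD₀1 hmf
  have hk1 : 1 ≤ k := le_trans (le_trans (le_max_left _ _) (le_max_left _ _)) hk₀k
  have hkN₁ : ⌈N₁⌉₊ ≤ k := le_trans (le_trans (le_max_right _ _) (le_max_left _ _)) hk₀k
  have hkk₁ : k₁ ≤ k := le_trans (le_max_right _ _) hk₀k
  -- Lemma 3.2 at `δ₁` on `n = 2k` qubits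
  have hB : 2 * Real.logb 2 (1 / (1 - δ₁ ^ 2)) + 9 ≤ ((2 * k : ℕ) : ℝ) := by
    calc 2 * Real.logb 2 (1 / (1 - δ₁ ^ 2)) + 9 = N₁ := rfl
      _ ≤ ⌈N₁⌉₊ := Nat.le_ceil N₁
      _ ≤ k := by exact_mod_cast hkN₁
      _ ≤ ((2 * k : ℕ) : ℝ) := by push_cast; linarith [(Nat.cast_nonneg k : (0 : ℝ) ≤ k)]
  obtain ⟨φ, hφ1, hφ⟩ := h32 δ₁ hδ₁0 hδ₁1 (2 * k) hB
  -- the precision `ε = 4^{-n}` and `δ + ε ≤ δ₁`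
  set ε : ℝ := (1 / 4 : ℝ) ^ (2 * k) with hεdef
  have hε0 : 0 ≤ ε := by positivity
  have hεδ : δ + ε ≤ δ₁ := by
    have : ε ≤ (1 / 4 : ℝ) ^ k₁ := pow_le_pow_of_le_one (by norm_num) (by norm_num) (by omega)
    rw [hδ₁def]; linarith
  -- Lemma 3.5: a circuit preparing `φ ⊗ |0^anc⟩` to precision `ε`, of `T`-count at most `m`
  obtain ⟨anc, U, hUfree, hUt, hUφ⟩ := h35 (2 * k) (by omega) φ hφ1
  have hUtm : U.tCount ≤ m := by
    have h2k : Real.sqrt 2 ^ (2 * k) = 2 ^ k := by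
      rw [pow_mul, Real.sq_sqrt (by norm_num : (0 : ℝ) ≤ 2)]
    have hkm' : ((D₀ * k * 2 ^ k : ℕ) : ℝ) ≤ m := by exact_mod_cast hkm
    have : (U.tCount : ℝ) ≤ m :=
      calc (U.tCount : ℝ) ≤ c * ((2 * k : ℕ) : ℝ) * Real.sqrt 2 ^ (2 * k) := hUt
        _ = 2 * c * (k * 2 ^ k) := by rw [h2k]; push_cast; ring
        _ ≤ D₀ * (k * 2 ^ k) := mul_le_mul_of_nonneg_right hD₀c (by positivity)
        _ = ((D₀ * k * 2 ^ k : ℕ) : ℝ) := by push_cast; ring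
        _ ≤ m := hkm'
    exact_mod_cast this
  -- pad `U` with `T` gates on `|0⟩` to `T`-count exactly `m`
  obtain ⟨U', hU'free, hU't, hU'0⟩ :=
    exists_tCount_eq_add (N := 2 * k + anc) (by omega) U hUfree (m - U.tCount) 0
  have hU'tm : U'.tCount = m := by omega
  -- the chain of §3.4
  have c1 : approxStabilizerRank δ (U.toMatrix 0 *ᵥ zeroState (2 * k + anc)) ≤
      approxStabilizerRank δ (tensorPow magicT m) := by
    have := h36 U' hU'free 0 δ
    rwa [hU'0, hU'tm] at this
  have c2 : approxStabilizerRank (δ + ε) (tensorVec φ (zeroState anc)) ≤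
      approxStabilizerRank δ (U.toMatrix 0 *ᵥ zeroState (2 * k + anc)) :=
    approxStabilizerRank_add_le hδ0.le hε0 hUφ
  have c3 : approxStabilizerRank (δ + ε) φ ≤
      approxStabilizerRank (δ + ε) (tensorVec φ (zeroState anc)) := h34a anc φ (δ + ε)
  have c4 : approxStabilizerRank δ₁ φ ≤ approxStabilizerRank (δ + ε) φ :=
    approxStabilizerRank_anti (pow_le_pow_left₀ (by positivity) hεδ 2) φ
  have hχ : C * (1 - δ₁ ^ 2) ^ 2 * 2 ^ (2 * k) / ((2 * k : ℕ) : ℝ) ^ 2 ≤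
      (approxStabilizerRank δ (tensorPow magicT m) : ℝ) :=
    hφ.trans (by exact_mod_cast c4.trans (c3.trans (c2.trans c1)))
  -- the arithmetic: `2^k ≤ m < 2 D₀ (k+1) 2^k`
  have h2km : 2 ^ k ≤ m := le_trans (Nat.le_mul_of_pos_left _ (Nat.mul_pos hD₀1 hk1)) hkm
  have hkL : (k : ℝ) * Real.log 2 ≤ Real.log m := by
    rw [← Real.log_pow]
    exact Real.log_le_log (by positivity) (by exact_mod_cast h2km)
  have hlL : Real.log 2 ≤ Real.log m := Real.log_le_log (by norm_num) (by exact_mod_cast hm2)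
  have hmR : (m : ℝ) < 2 * D₀ * (k + 1) * 2 ^ k :=
    calc (m : ℝ) < ((D₀ * (k + 1) * 2 ^ (k + 1) : ℕ) : ℝ) := by exact_mod_cast hmk
      _ = 2 * D₀ * (k + 1) * 2 ^ k := by push_cast; ring
  calc C * (1 - δ₁ ^ 2) ^ 2 * Real.log 2 ^ 4 / (64 * (D₀ : ℝ) ^ 2) * (m : ℝ) ^ 2 / Real.log m ^ 4
      ≤ C * (1 - δ₁ ^ 2) ^ 2 * 2 ^ (2 * k) / ((2 * k : ℕ) : ℝ) ^ 2 :=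
        MehrabanTahmasbi2024.quadratic_arith (by positivity) hD₀1 hk1 hl2 hlL hkL hmR
    _ ≤ _ := hχ

/-! ### Theorem 3.1 by the exact sign-state route (S1, S2, S3 ⇒ the fact) -/

namespace MehrabanTahmasbi2024

open ApproxRankTypical (signVec)

/-- **Exact sign-state synthesis with `T`-count `≤ 7c₀ · 2^k` on `2k` qubits**, from an exact
oracle family with `≤ c₀ 2^k` Toffoli gates (S2) and the kickback synthesis (S3).
[cite: GossetKothariWu2024, Lemma 2.1 and Remark 2.2 (arXiv p. 8)] -/
theorem signPrep_of
    (h2 : ∃ c₀ : ℕ, ∀ k : ℕ, 1 ≤ k → ∀ f : QReg (2 * k) → Bool,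
      ∃ (a : ℕ) (ops : List (RevOp (2 * k + (1 + a)))), toffCount ops ≤ c₀ * 2 ^ k ∧
        ∀ (x : QReg (2 * k)) (b : Bool), revEval ops (layout x b) = layout x (xor b (f x)))
    (h3 : ∀ {n a : ℕ} (f : QReg n → Bool) (ops : List (RevOp (n + (1 + a)))),
      (∀ (x : QReg n) (b : Bool), revEval ops (layout x b) = layout x (xor b (f x))) →
      ∃ U : QCircuit cliffordT (n + (1 + a)), U.IsOracleFree ∧ U.tCount ≤ 7 * toffCount ops ∧
        U.toMatrix 0 *ᵥ zeroState (n + (1 + a)) = tensorVec (signVec f) (zeroState (1 + a)))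
    : ∃ c₁ : ℕ, ∀ (k : ℕ), 1 ≤ k → ∀ (s : QReg (2 * k) → Bool),
    ∃ (anc : ℕ) (U : QCircuit cliffordT (2 * k + anc)), U.IsOracleFree ∧
      U.tCount ≤ c₁ * 2 ^ k ∧
      U.toMatrix 0 *ᵥ zeroState (2 * k + anc) = tensorVec (signVec s) (zeroState anc) := by
  obtain ⟨c₀, h2⟩ := h2
  refine ⟨7 * c₀, fun k hk s => ?_⟩
  obtain ⟨a, ops, hcnt, hsem⟩ := h2 k hk s
  obtain ⟨U, hUfree, hUt, hU0⟩ := h3 s ops hsem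
  refine ⟨1 + a, U, hUfree, ?_, hU0⟩
  calc U.tCount ≤ 7 * toffCount ops := hUt
    _ ≤ 7 * (c₀ * 2 ^ k) := Nat.mul_le_mul_left _ hcnt
    _ = 7 * c₀ * 2 ^ k := by ring

end MehrabanTahmasbi2024

open ApproxRankTypical (signVec) in
/-- **Mehraban–Tahmasbi 2024, Theorem 3.1 from the three sign-state ingredients** S1 (a sign
state `φ_s` on `n` qubits with `χ_δ(φ_s) ≥ C(1−δ²)² 2ⁿ/n²`), S2 (exact reversible oracles with
`≤ c₀ 2^{n/2}` Toffoli gates), S3 (exact kickback synthesis, `7` `T` per Toffoli), together with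
the tree's proved Lemma 3.6 (`…_output_le_holds`) and §3.4 (a) (`…_le_tensor_zeroState_holds`):
`χ_δ(|T⟩^{⊗m}) ≥ χ_δ(U|0⟩) = χ_δ(φ_s ⊗ |0^anc⟩) ≥ χ_δ(φ_s) ≥ C(1−δ²)² 2^{2k}/(2k)²` with
`D₀ k 2^k ≤ m < D₀ (k+1) 2^{k+1}`, `D₀ = 7c₀ + 1` — the printed §3.4 chain with NO approximation
parameter (the preparation is exact). [cite: MehrabanTahmasbi2024, §3.4 (arXiv pp. 14–15)] -/
theorem MehrabanTahmasbi2024_approxRank_magicT_quadratic_of_signStubs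
    (h1 : ∃ C : ℝ, 1 / 1000 ≤ C ∧ ∀ (δ : ℝ), 0 < δ → δ < 1 → ∀ n : ℕ,
      2 * Real.logb 2 (1 / (1 - δ ^ 2)) + 9 ≤ (n : ℝ) →
        ∃ s : QReg n → Bool, C * (1 - δ ^ 2) ^ 2 * (2 : ℝ) ^ n / (n : ℝ) ^ 2 ≤
          (approxStabilizerRank δ (signVec s) : ℝ))
    (h2 : ∃ c₀ : ℕ, ∀ k : ℕ, 1 ≤ k → ∀ f : QReg (2 * k) → Bool,
      ∃ (a : ℕ) (ops : List (RevOp (2 * k + (1 + a)))), toffCount ops ≤ c₀ * 2 ^ k ∧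
        ∀ (x : QReg (2 * k)) (b : Bool), revEval ops (layout x b) = layout x (xor b (f x)))
    (h3 : ∀ {n a : ℕ} (f : QReg n → Bool) (ops : List (RevOp (n + (1 + a)))),
      (∀ (x : QReg n) (b : Bool), revEval ops (layout x b) = layout x (xor b (f x))) →
      ∃ U : QCircuit cliffordT (n + (1 + a)), U.IsOracleFree ∧ U.tCount ≤ 7 * toffCount ops ∧
        U.toMatrix 0 *ᵥ zeroState (n + (1 + a)) = tensorVec (signVec f) (zeroState (1 + a))) :
    MehrabanTahmasbi2024_approxRank_magicT_quadratic := by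
  obtain ⟨c₁, hprep⟩ := MehrabanTahmasbi2024.signPrep_of h2 h3
  intro δ hδ0 hδ1
  obtain ⟨C, hC, h32⟩ := h1
  have h1δ : 0 < 1 - δ ^ 2 := by nlinarith
  have hC0 : 0 < C := by linarith
  have hl2 : 0 < Real.log 2 := Real.log_pos (by norm_num)
  set D₀ : ℕ := c₁ + 1 with hD₀def
  have hD₀1 : 1 ≤ D₀ := by omega
  set N₁ : ℝ := 2 * Real.logb 2 (1 / (1 - δ ^ 2)) + 9 with hN₁def
  set k₀ : ℕ := max 1 ⌈N₁⌉₊ with hk₀def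
  refine ⟨C * (1 - δ ^ 2) ^ 2 * Real.log 2 ^ 4 / (64 * (D₀ : ℝ) ^ 2), by positivity, 4,
    max (D₀ * k₀ * 2 ^ k₀) 2, fun m hm => ?_⟩
  have hm2 : 2 ≤ m := le_of_max_le_right hm
  have hmf : D₀ * k₀ * 2 ^ k₀ ≤ m := le_of_max_le_left hm
  -- the choice of `n = 2k`
  obtain ⟨k, hk₀k, hkm, hmk⟩ := MehrabanTahmasbi2024.exists_bracket hD₀1 hmf
  have hk1 : 1 ≤ k := le_trans (le_max_left _ _) hk₀k
  have hkN₁ : ⌈N₁⌉₊ ≤ k := le_trans (le_max_right _ _) hk₀k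
  -- S1 at `δ` on `n = 2k` qubits: a sign state of large approximate rank
  have hB : 2 * Real.logb 2 (1 / (1 - δ ^ 2)) + 9 ≤ ((2 * k : ℕ) : ℝ) := by
    calc 2 * Real.logb 2 (1 / (1 - δ ^ 2)) + 9 = N₁ := rfl
      _ ≤ ⌈N₁⌉₊ := Nat.le_ceil N₁
      _ ≤ k := by exact_mod_cast hkN₁
      _ ≤ ((2 * k : ℕ) : ℝ) := by push_cast; linarith [(Nat.cast_nonneg k : (0 : ℝ) ≤ k)]
  obtain ⟨s, hφ⟩ := h32 δ hδ0 hδ1 (2 * k) hB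
  -- S2 + S3: an EXACT circuit preparing `φ_s ⊗ |0^anc⟩`, of `T`-count at most `m`
  obtain ⟨anc, U, hUfree, hUt, hUφ⟩ := hprep k hk1 s
  have hUtm : U.tCount ≤ m := by
    calc U.tCount ≤ c₁ * 2 ^ k := hUt
      _ ≤ D₀ * k * 2 ^ k := by
          rw [hD₀def]
          calc c₁ * 2 ^ k = c₁ * 1 * 2 ^ k := by ring
            _ ≤ (c₁ + 1) * k * 2 ^ k := by gcongr; omega
      _ ≤ m := hkm
  -- pad `U` with `T` gates on `|0⟩` to `T`-count exactly `m`
  obtain ⟨U', hU'free, hU't, hU'0⟩ :=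
    exists_tCount_eq_add (N := 2 * k + anc) (by omega) U hUfree (m - U.tCount) 0
  have hU'tm : U'.tCount = m := by omega
  -- the chain (no perturbation step: the preparation is exact)
  have c1 : approxStabilizerRank δ (U.toMatrix 0 *ᵥ zeroState (2 * k + anc)) ≤
      approxStabilizerRank δ (tensorPow magicT m) := by
    have := MehrabanTahmasbi2024_approxRank_output_le_holds U' hU'free 0 δ
    rwa [hU'0, hU'tm] at this
  have c3 : approxStabilizerRank δ (signVec s) ≤
      approxStabilizerRank δ (tensorVec (signVec s) (zeroState anc)) :=
    MehrabanTahmasbi2024_approxRank_le_tensor_zeroState_holds anc (signVec s) δ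
  have hχ : C * (1 - δ ^ 2) ^ 2 * 2 ^ (2 * k) / ((2 * k : ℕ) : ℝ) ^ 2 ≤
      (approxStabilizerRank δ (tensorPow magicT m) : ℝ) := by
    refine hφ.trans ?_
    rw [hUφ] at c1
    exact_mod_cast c3.trans c1
  -- the arithmetic: `2^k ≤ m < 2 D₀ (k+1) 2^k`
  have h2km : 2 ^ k ≤ m := le_trans (Nat.le_mul_of_pos_left _ (Nat.mul_pos hD₀1 hk1)) hkm
  have hkL : (k : ℝ) * Real.log 2 ≤ Real.log m := by
    rw [← Real.log_pow]
    exact Real.log_le_log (by positivity) (by exact_mod_cast h2km)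
  have hlL : Real.log 2 ≤ Real.log m := Real.log_le_log (by norm_num) (by exact_mod_cast hm2)
  have hmR : (m : ℝ) < 2 * D₀ * (k + 1) * 2 ^ k :=
    calc (m : ℝ) < ((D₀ * (k + 1) * 2 ^ (k + 1) : ℕ) : ℝ) := by exact_mod_cast hmk
      _ = 2 * D₀ * (k + 1) * 2 ^ k := by push_cast; ring
  calc C * (1 - δ ^ 2) ^ 2 * Real.log 2 ^ 4 / (64 * (D₀ : ℝ) ^ 2) * (m : ℝ) ^ 2 / Real.log m ^ 4
      ≤ C * (1 - δ ^ 2) ^ 2 * 2 ^ (2 * k) / ((2 * k : ℕ) : ℝ) ^ 2 :=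
        MehrabanTahmasbi2024.quadratic_arith (by positivity) hD₀1 hk1 hl2 hlL hkL hmR
    _ ≤ _ := hχ

/-- **Mehraban–Tahmasbi 2024, Theorem 3.1 — PROVED** (the named fact
`MehrabanTahmasbi2024_approxRank_magicT_quadratic` discharged): for every `0 < δ < 1` there are
`c > 0`, `A` (`= 4`) and `m₀` with `c · m² / (log m)^A ≤ χ_δ(|T⟩^{⊗m})` for all `m ≥ m₀`. The
three ingredients are the tree's theorems `MehrabanTahmasbi2024_exists_large_approxRank_signVec`
(S1, Lemma 3.2 with a sign-state witness), `boolOracle_exact` (S2, Gosset–Kothari–Wu 2024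
Remark 2.2) and `signState_exact_synthesis` (S3, phase kickback).
[cite: MehrabanTahmasbi2024, Thm 3.1 (arXiv p. 12) and §3.4 (pp. 14–15)] -/
theorem MehrabanTahmasbi2024_approxRank_magicT_quadratic_holds :
    MehrabanTahmasbi2024_approxRank_magicT_quadratic :=
  MehrabanTahmasbi2024_approxRank_magicT_quadratic_of_signStubs
    MehrabanTahmasbi2024_exists_large_approxRank_signVec ⟨8, boolOracle_exact⟩
    (fun f ops h => signState_exact_synthesis f ops h)

end Literature.Computability.QuantumComplexity

end
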